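import Mathlib.Tactic.DefEqTransformations
import Summits.CriticalPhenomena.PercolationContinuityZ3.Theorems.PercNearOneGluingNoHeavyLowerTailKnQuestion8CoefficientwiseAttachmentSelector
import Summits.CriticalPhenomena.PercolationContinuityZ3.Theorems.PercNearOneGluingNoHeavyLowerTailKnQuestion8CoefficientwiseAttachmentCanonical
import HarnessLib

/-!
# The residue identity of the POINT ROW, kernel form II: the CLOSED canonical selector `A**` (non-zone neighbours absorbed)

Support file (`--supports stmt-CriticalPhenomena-4575`, closed), prover `prim-lf-2` (gen 36).  No definitions, no named facts, no sorries; standard axioms.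
Memo `prim-lf-2/CW-RESIDUE-gen36.md` §1 (and `CW-INVOLUTION-gen35.md` §2).

Setting as in …CoefficientwiseAttachmentSelector: finite multigraph `ends : ι → Sym2 V`, edge set `E`, root `x`, wall vertex `z`, points `u, w`,
colouring `s ⊆ E` (red) / `E \ s` (blue), `C(t) = openCluster (ends '' t) x`, zone `U(s) = C(s) ∪ C(E \ s)`, core `D(s) = C(s) ∩ C(E \ s)`,
`σ_v(s) = 1[v ∈ C(s)] − 1[v ∈ C(E \ s)]`, point row `P = Σ_{s : z ∉ U(s)} σ_u(s) σ_w(s)`.  `W` is ATTACHED for `s` if every zone vertex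
`v' ∉ W ∪ {x}` joined to `W` by an edge lies in `C(s \ I(W)) ∩ C((E \ s) \ I(W))`, `I(W)` = the edges meeting `W`.  The LOBE of `w` is its component
in the graph of the edges with both ends in `U(s) \ D(s)`.  Companion of …CoefficientwiseAttachmentResidue (selector `A*`).  Here the CLOSED CANONICAL SELECTOR is
  `A**(s) := ⋂₀ {W | x ∉ W, lobe_w(s) ⊆ W, W attached for s, W closed under non-zone neighbours}`
('closed': every vertex outside the zone `U(s)` joined to `W` by an edge lies in `W`; vertices outside the zone are harmless passengers of an attachment flip,
…AttachmentFlipWeak).  `A** ⊇ A*`; its point is prim-lf-2 gen 36's RESIDUE DECOMPOSITION (memo CW-RESIDUE-gen36 §2): the shadow `S` of `A**(s)` has all its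
outside neighbours in the core, so the entangled residue splits over `S` into nonnegative multiples of FULL-closure sums of the quotients `G[S ∪ ∂S]/∂S` with
PLAIN wall sets — with `A*` the quotients acquire 'attached wall vertices', for which the analogous sums can be negative (7-vertex witness in the memo).
This file proves, for ANY map `𝓐` satisfying the defining equation `𝓐 s = A**(s)` (names as in the companion file with suffix `Closed`):
* `Coefficientwise.not_mem_aStarClosed` / `mem_aStarClosed` / `attached_aStarClosed` / `closed_aStarClosed` — `x ∉ A**(s)`, `w ∈ A**(s)`, `A**(s)` is
  attached (…AttachmentCanonical `attached_sInter`) and closed;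
* `Coefficientwise.aStarClosed_flip_eq` — FLIP INVARIANCE `A**(s ∆ I(A**(s))) = A**(s)` (zone, core and lobes are unchanged by the flip — …AttachmentFlipWeak,
  …AttachmentCanonical `lobe_flip_eq` — and attached subsets of `A*(s)` are the same before and after it — …AttachmentStable `attached_flip_iff`);
* `Coefficientwise.pointRow_sum_eq_sum_entangledClosed` — **residue identity for `A**`**: `Σ_{wall} σ_u σ_w
      = Σ_{wall, u ∈ A**(s)} σ_u σ_w` (…AttachmentSelector `pointRow_sum_eq_sum_not_good` with the
  selector `A*`, whose GOOD colourings are exactly the FREE ones `u ∉ A*(s)` by the three facts and the flip invariance);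
* `Coefficientwise.pointRow_sum_freeClosed_eq_zero` — the colourings with `u ∉ A**(s)` contribute zero.
[cite: KozmaNitzan2024, Questions 8–9 (§5.5 p. 36) (context: the Question-8 pocket covariance programme)]
-/

namespace Summit.CriticalPhenomena.PercolationContinuityZ3.Theorems

open Finset Literature.Probability.Percolation
open scoped symmDiff

namespace Coefficientwise

variable {ι V : Type*}

open Classical in
/-- `x ∉ A**(s)` (for `w ≠ x` the set `{v | v ≠ x}` contains the lobe of `w` — the root is a core vertex and lobe edges avoid the core — and is
vacuously attached). [cite: KozmaNitzan2024, §5.5 (context only)] -/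
theorem not_mem_aStarClosed (ends : ι → Sym2 V) (E : Finset ι) (x w : V) (hwx : w ≠ x) (𝓐 : Finset ι → Set V)
    (h𝓐 : ∀ s : Finset ι, 𝓐 s = ⋂₀ {W : Set V | x ∉ W ∧
        openCluster (ends '' (↑(E.filter (fun i => ∀ y ∈ ends i,
          (y ∈ openCluster (ends '' (↑s : Set ι)) x ∨ y ∈ openCluster (ends '' (↑(E \ s) : Set ι)) x) ∧
          ¬ (y ∈ openCluster (ends '' (↑s : Set ι)) x ∧ y ∈ openCluster (ends '' (↑(E \ s) : Set ι)) x))) : Set ι)) w ⊆ W ∧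
        (∀ v ∈ W, ∀ i ∈ E, ∀ v', ends i = s(v, v') →
          (v' ∈ openCluster (ends '' (↑s : Set ι)) x ∨ v' ∈ openCluster (ends '' (↑(E \ s) : Set ι)) x) → v' ≠ x → v' ∉ W →
            v' ∈ openCluster (ends '' (↑(s \ E.filter (fun i => ∃ v, v ∈ W ∧ v ∈ ends i)) : Set ι)) x ∧
            v' ∈ openCluster (ends '' (↑((E \ s) \ E.filter (fun i => ∃ v, v ∈ W ∧ v ∈ ends i)) : Set ι)) x) ∧
        (∀ v ∈ W, ∀ i ∈ E, ∀ v', ends i = s(v, v') → ¬ (v' ∈ openCluster (ends '' (↑s : Set ι)) x ∨ v' ∈ openCluster (ends '' (↑(E \ s) : Set ι)) x) → v' ∈ W)})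
    (s : Finset ι) : x ∉ 𝓐 s := by
  rw [h𝓐 s]
  have hmem : {v : V | v ≠ x} ∈ {W : Set V | x ∉ W ∧
        openCluster (ends '' (↑(E.filter (fun i => ∀ y ∈ ends i,
          (y ∈ openCluster (ends '' (↑s : Set ι)) x ∨ y ∈ openCluster (ends '' (↑(E \ s) : Set ι)) x) ∧
          ¬ (y ∈ openCluster (ends '' (↑s : Set ι)) x ∧ y ∈ openCluster (ends '' (↑(E \ s) : Set ι)) x))) : Set ι)) w ⊆ W ∧
        (∀ v ∈ W, ∀ i ∈ E, ∀ v', ends i = s(v, v') →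
          (v' ∈ openCluster (ends '' (↑s : Set ι)) x ∨ v' ∈ openCluster (ends '' (↑(E \ s) : Set ι)) x) → v' ≠ x → v' ∉ W →
            v' ∈ openCluster (ends '' (↑(s \ E.filter (fun i => ∃ v, v ∈ W ∧ v ∈ ends i)) : Set ι)) x ∧
            v' ∈ openCluster (ends '' (↑((E \ s) \ E.filter (fun i => ∃ v, v ∈ W ∧ v ∈ ends i)) : Set ι)) x) ∧
        (∀ v ∈ W, ∀ i ∈ E, ∀ v', ends i = s(v, v') → ¬ (v' ∈ openCluster (ends '' (↑s : Set ι)) x ∨ v' ∈ openCluster (ends '' (↑(E \ s) : Set ι)) x)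
              → v' ∈ W)} := by
    refine ⟨fun h => h rfl, ?_, ?_, ?_⟩
    · intro y hy hyx
      have hyx' : y = x := by simpa using hyx
      subst hyx'
      obtain ⟨e, he, hye⟩ := exists_edge_of_mem_openCluster ends hy hwx.symm
      rw [Finset.mem_filter] at he
      exact (he.2 _ hye).2 ⟨mem_openCluster_self _ _, mem_openCluster_self _ _⟩
    · intro v hv i hi v' he hU hne hnW
      exact absurd (by simpa using hne) hnW
    · intro v hv i hi v' he hnz
      have hne : v' ≠ x := by
        rintro rfl
        exact hnz (Or.inl (mem_openCluster_self _ _))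
      simpa using hne
  intro hx
  exact (Set.mem_sInter.mp hx _ hmem) rfl

open Classical in
/-- `w ∈ A**(s)` (every member of the family contains the lobe of `w`, which contains `w`). [cite: KozmaNitzan2024, §5.5 (context only)] -/
theorem mem_aStarClosed (ends : ι → Sym2 V) (E : Finset ι) (x w : V) (𝓐 : Finset ι → Set V)
    (h𝓐 : ∀ s : Finset ι, 𝓐 s = ⋂₀ {W : Set V | x ∉ W ∧
        openCluster (ends '' (↑(E.filter (fun i => ∀ y ∈ ends i,
          (y ∈ openCluster (ends '' (↑s : Set ι)) x ∨ y ∈ openCluster (ends '' (↑(E \ s) : Set ι)) x) ∧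
          ¬ (y ∈ openCluster (ends '' (↑s : Set ι)) x ∧ y ∈ openCluster (ends '' (↑(E \ s) : Set ι)) x))) : Set ι)) w ⊆ W ∧
        (∀ v ∈ W, ∀ i ∈ E, ∀ v', ends i = s(v, v') →
          (v' ∈ openCluster (ends '' (↑s : Set ι)) x ∨ v' ∈ openCluster (ends '' (↑(E \ s) : Set ι)) x) → v' ≠ x → v' ∉ W →
            v' ∈ openCluster (ends '' (↑(s \ E.filter (fun i => ∃ v, v ∈ W ∧ v ∈ ends i)) : Set ι)) x ∧
            v' ∈ openCluster (ends '' (↑((E \ s) \ E.filter (fun i => ∃ v, v ∈ W ∧ v ∈ ends i)) : Set ι)) x) ∧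
        (∀ v ∈ W, ∀ i ∈ E, ∀ v', ends i = s(v, v') → ¬ (v' ∈ openCluster (ends '' (↑s : Set ι)) x ∨ v' ∈ openCluster (ends '' (↑(E \ s) : Set ι)) x) → v' ∈ W)})
    (s : Finset ι) : w ∈ 𝓐 s := by
  rw [h𝓐 s]
  exact Set.mem_sInter.mpr fun W hW => hW.2.1 (mem_openCluster_self _ _)

open Classical in
/-- The lobe of `w` lies in `A**(s)`. [cite: KozmaNitzan2024, §5.5 (context only)] -/
theorem lobe_subset_aStarClosed (ends : ι → Sym2 V) (E : Finset ι) (x w : V) (𝓐 : Finset ι → Set V)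
    (h𝓐 : ∀ s : Finset ι, 𝓐 s = ⋂₀ {W : Set V | x ∉ W ∧
        openCluster (ends '' (↑(E.filter (fun i => ∀ y ∈ ends i,
          (y ∈ openCluster (ends '' (↑s : Set ι)) x ∨ y ∈ openCluster (ends '' (↑(E \ s) : Set ι)) x) ∧
          ¬ (y ∈ openCluster (ends '' (↑s : Set ι)) x ∧ y ∈ openCluster (ends '' (↑(E \ s) : Set ι)) x))) : Set ι)) w ⊆ W ∧
        (∀ v ∈ W, ∀ i ∈ E, ∀ v', ends i = s(v, v') →
          (v' ∈ openCluster (ends '' (↑s : Set ι)) x ∨ v' ∈ openCluster (ends '' (↑(E \ s) : Set ι)) x) → v' ≠ x → v' ∉ W →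
            v' ∈ openCluster (ends '' (↑(s \ E.filter (fun i => ∃ v, v ∈ W ∧ v ∈ ends i)) : Set ι)) x ∧
            v' ∈ openCluster (ends '' (↑((E \ s) \ E.filter (fun i => ∃ v, v ∈ W ∧ v ∈ ends i)) : Set ι)) x) ∧
        (∀ v ∈ W, ∀ i ∈ E, ∀ v', ends i = s(v, v') → ¬ (v' ∈ openCluster (ends '' (↑s : Set ι)) x ∨ v' ∈ openCluster (ends '' (↑(E \ s) : Set ι)) x) → v' ∈ W)})
    (s : Finset ι) :
    openCluster (ends '' (↑(E.filter (fun i => ∀ y ∈ ends i,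
          (y ∈ openCluster (ends '' (↑s : Set ι)) x ∨ y ∈ openCluster (ends '' (↑(E \ s) : Set ι)) x) ∧
          ¬ (y ∈ openCluster (ends '' (↑s : Set ι)) x ∧ y ∈ openCluster (ends '' (↑(E \ s) : Set ι)) x))) : Set ι)) w ⊆ 𝓐 s := by
  rw [h𝓐 s]
  exact Set.subset_sInter fun W hW => hW.2.1

open Classical in
/-- `A**(s)` is attached for `s` (intersections of attached sets are attached, …AttachmentCanonical). [cite: KozmaNitzan2024, §5.5 (context only)] -/
theorem attached_aStarClosed (ends : ι → Sym2 V) (E : Finset ι) (x w : V) (𝓐 : Finset ι → Set V)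
    (h𝓐 : ∀ s : Finset ι, 𝓐 s = ⋂₀ {W : Set V | x ∉ W ∧
        openCluster (ends '' (↑(E.filter (fun i => ∀ y ∈ ends i,
          (y ∈ openCluster (ends '' (↑s : Set ι)) x ∨ y ∈ openCluster (ends '' (↑(E \ s) : Set ι)) x) ∧
          ¬ (y ∈ openCluster (ends '' (↑s : Set ι)) x ∧ y ∈ openCluster (ends '' (↑(E \ s) : Set ι)) x))) : Set ι)) w ⊆ W ∧
        (∀ v ∈ W, ∀ i ∈ E, ∀ v', ends i = s(v, v') →
          (v' ∈ openCluster (ends '' (↑s : Set ι)) x ∨ v' ∈ openCluster (ends '' (↑(E \ s) : Set ι)) x) → v' ≠ x → v' ∉ W →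
            v' ∈ openCluster (ends '' (↑(s \ E.filter (fun i => ∃ v, v ∈ W ∧ v ∈ ends i)) : Set ι)) x ∧
            v' ∈ openCluster (ends '' (↑((E \ s) \ E.filter (fun i => ∃ v, v ∈ W ∧ v ∈ ends i)) : Set ι)) x) ∧
        (∀ v ∈ W, ∀ i ∈ E, ∀ v', ends i = s(v, v') → ¬ (v' ∈ openCluster (ends '' (↑s : Set ι)) x ∨ v' ∈ openCluster (ends '' (↑(E \ s) : Set ι)) x) → v' ∈ W)})
    (s : Finset ι) :
    (∀ v ∈ 𝓐 s, ∀ i ∈ E, ∀ v', ends i = s(v, v') →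
          (v' ∈ openCluster (ends '' (↑s : Set ι)) x ∨ v' ∈ openCluster (ends '' (↑(E \ s) : Set ι)) x) → v' ≠ x → v' ∉ 𝓐 s →
            v' ∈ openCluster (ends '' (↑(s \ E.filter (fun i => ∃ v, v ∈ 𝓐 s ∧ v ∈ ends i)) : Set ι)) x ∧
            v' ∈ openCluster (ends '' (↑((E \ s) \ E.filter (fun i => ∃ v, v ∈ 𝓐 s ∧ v ∈ ends i)) : Set ι)) x) := by
  rw [h𝓐 s]
  exact attached_sInter ends (E₀ := E) (s := s) (z := x) _ fun W hW => hW.2.2.1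

open Classical in
/-- `A**(s)` is closed under non-zone neighbours (an intersection of closed sets). [cite: KozmaNitzan2024, §5.5 (context only)] -/
theorem closed_aStarClosed (ends : ι → Sym2 V) (E : Finset ι) (x w : V) (𝓐 : Finset ι → Set V)
    (h𝓐 : ∀ s : Finset ι, 𝓐 s = ⋂₀ {W : Set V | x ∉ W ∧
        openCluster (ends '' (↑(E.filter (fun i => ∀ y ∈ ends i,
          (y ∈ openCluster (ends '' (↑s : Set ι)) x ∨ y ∈ openCluster (ends '' (↑(E \ s) : Set ι)) x) ∧
          ¬ (y ∈ openCluster (ends '' (↑s : Set ι)) x ∧ y ∈ openCluster (ends '' (↑(E \ s) : Set ι)) x))) : Set ι)) w ⊆ W ∧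
        (∀ v ∈ W, ∀ i ∈ E, ∀ v', ends i = s(v, v') →
          (v' ∈ openCluster (ends '' (↑s : Set ι)) x ∨ v' ∈ openCluster (ends '' (↑(E \ s) : Set ι)) x) → v' ≠ x → v' ∉ W →
            v' ∈ openCluster (ends '' (↑(s \ E.filter (fun i => ∃ v, v ∈ W ∧ v ∈ ends i)) : Set ι)) x ∧
            v' ∈ openCluster (ends '' (↑((E \ s) \ E.filter (fun i => ∃ v, v ∈ W ∧ v ∈ ends i)) : Set ι)) x) ∧
        (∀ v ∈ W, ∀ i ∈ E, ∀ v', ends i = s(v, v') → ¬ (v' ∈ openCluster (ends '' (↑s : Set ι)) x ∨ v' ∈ openCluster (ends '' (↑(E \ s) : Set ι)) x) → v' ∈ W)})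
    (s : Finset ι) :
    (∀ v ∈ 𝓐 s, ∀ i ∈ E, ∀ v', ends i = s(v, v') → ¬ (v' ∈ openCluster (ends '' (↑s : Set ι)) x ∨ v' ∈ openCluster (ends '' (↑(E \ s) : Set ι)) x)
          → v' ∈ 𝓐 s) := by
  rw [h𝓐 s]
  intro v hv i hi v' he hnz
  exact Set.mem_sInter.mpr fun W hW => hW.2.2.2 v (Set.mem_sInter.mp hv W hW) i hi v' he hnz

open Classical in
/-- **Flip invariance of the closed canonical selector**: `A**(s ∆ I(A**(s))) = A**(s)` for `s ⊆ E`, `w ≠ x`.  (`A**(s)` belongs to the family of the flipped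
colouring — same lobe, attachment transported by …AttachmentStable `attached_flip_iff` — so `A*(s') ⊆ A*(s)`; and `A*(s')`, being an attached subset of
`A*(s)` for `s'`, is attached for `s` and contains the lobe, so `A*(s) ⊆ A*(s')`.) [cite: KozmaNitzan2024, §5.5 (context only)] -/
theorem aStarClosed_flip_eq (ends : ι → Sym2 V) (E : Finset ι) (x w : V) (hwx : w ≠ x) (𝓐 : Finset ι → Set V)
    (h𝓐 : ∀ s : Finset ι, 𝓐 s = ⋂₀ {W : Set V | x ∉ W ∧
        openCluster (ends '' (↑(E.filter (fun i => ∀ y ∈ ends i,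
          (y ∈ openCluster (ends '' (↑s : Set ι)) x ∨ y ∈ openCluster (ends '' (↑(E \ s) : Set ι)) x) ∧
          ¬ (y ∈ openCluster (ends '' (↑s : Set ι)) x ∧ y ∈ openCluster (ends '' (↑(E \ s) : Set ι)) x))) : Set ι)) w ⊆ W ∧
        (∀ v ∈ W, ∀ i ∈ E, ∀ v', ends i = s(v, v') →
          (v' ∈ openCluster (ends '' (↑s : Set ι)) x ∨ v' ∈ openCluster (ends '' (↑(E \ s) : Set ι)) x) → v' ≠ x → v' ∉ W →
            v' ∈ openCluster (ends '' (↑(s \ E.filter (fun i => ∃ v, v ∈ W ∧ v ∈ ends i)) : Set ι)) x ∧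
            v' ∈ openCluster (ends '' (↑((E \ s) \ E.filter (fun i => ∃ v, v ∈ W ∧ v ∈ ends i)) : Set ι)) x) ∧
        (∀ v ∈ W, ∀ i ∈ E, ∀ v', ends i = s(v, v') → ¬ (v' ∈ openCluster (ends '' (↑s : Set ι)) x ∨ v' ∈ openCluster (ends '' (↑(E \ s) : Set ι)) x) → v' ∈ W)})
    (s : Finset ι) (hs : s ⊆ E) :
    𝓐 (s ∆ E.filter (fun i => ∃ v, v ∈ 𝓐 s ∧ v ∈ ends i)) = 𝓐 s := by
  have hxA := not_mem_aStarClosed ends E x w hwx 𝓐 h𝓐 s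
  have hAtt := attached_aStarClosed ends E x w 𝓐 h𝓐 s
  have hlobe := lobe_subset_aStarClosed ends E x w 𝓐 h𝓐 s
  -- the flipped colouring
  have hs' : s ∆ E.filter (fun i => ∃ v, v ∈ 𝓐 s ∧ v ∈ ends i) ⊆ E := by
    intro i hi
    rcases Finset.mem_symmDiff.mp hi with ⟨h, -⟩ | ⟨h, -⟩
    · exact hs h
    · exact (Finset.mem_filter.mp h).1
  have hCl := closed_aStarClosed ends E x w 𝓐 h𝓐 s
  -- zone and lobe invariance
  have hU := union_flip_eq_attachment ends hs (𝓐 s) hxA hAtt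
  have hUy : ∀ y, (y ∈ openCluster (ends '' (↑(s ∆ E.filter (fun i => ∃ v, v ∈ 𝓐 s ∧ v ∈ ends i)) : Set ι)) x
        ∨ y ∈ openCluster (ends '' (↑(E \ (s ∆ E.filter (fun i => ∃ v, v ∈ 𝓐 s ∧ v ∈ ends i))) : Set ι)) x) ↔
      (y ∈ openCluster (ends '' (↑s : Set ι)) x ∨ y ∈ openCluster (ends '' (↑(E \ s) : Set ι)) x) := by
    intro y
    have h := congrArg (fun S : Set V => y ∈ S) hU
    simpa only [Set.mem_union, eq_iff_iff] using h
  have hL := lobe_flip_eq ends hs (𝓐 s) hxA hAtt w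
  -- facts for the flipped colouring
  have hxA' := not_mem_aStarClosed ends E x w hwx 𝓐 h𝓐 (s ∆ E.filter (fun i => ∃ v, v ∈ 𝓐 s ∧ v ∈ ends i))
  have hAtt' := attached_aStarClosed ends E x w 𝓐 h𝓐 (s ∆ E.filter (fun i => ∃ v, v ∈ 𝓐 s ∧ v ∈ ends i))
  have hlobe' := lobe_subset_aStarClosed ends E x w 𝓐 h𝓐 (s ∆ E.filter (fun i => ∃ v, v ∈ 𝓐 s ∧ v ∈ ends i))
  have hCl' := closed_aStarClosed ends E x w 𝓐 h𝓐 (s ∆ E.filter (fun i => ∃ v, v ∈ 𝓐 s ∧ v ∈ ends i))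
  apply Set.Subset.antisymm
  · -- `A*(s)` is in the family of `s'`
    have hmem : 𝓐 s ∈ {W : Set V | x ∉ W ∧
        openCluster (ends '' (↑(E.filter (fun i => ∀ y ∈ ends i,
          (y ∈ openCluster (ends '' (↑(s ∆ E.filter (fun i => ∃ v, v ∈ 𝓐 s ∧ v ∈ ends i)) : Set ι)) x
                ∨ y ∈ openCluster (ends '' (↑(E \ (s ∆ E.filter (fun i => ∃ v, v ∈ 𝓐 s ∧ v ∈ ends i))) : Set ι)) x) ∧
          ¬ (y ∈ openCluster (ends '' (↑(s ∆ E.filter (fun i => ∃ v, v ∈ 𝓐 s ∧ v ∈ ends i)) : Set ι)) x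
                ∧ y ∈ openCluster (ends '' (↑(E \ (s ∆ E.filter (fun i => ∃ v, v ∈ 𝓐 s ∧ v ∈ ends i))) : Set ι)) x))) : Set ι)) w ⊆ W ∧
        (∀ v ∈ W, ∀ i ∈ E, ∀ v', ends i = s(v, v') →
          (v' ∈ openCluster (ends '' (↑(s ∆ E.filter (fun i => ∃ v, v ∈ 𝓐 s ∧ v ∈ ends i)) : Set ι)) x
                ∨ v' ∈ openCluster (ends '' (↑(E \ (s ∆ E.filter (fun i => ∃ v, v ∈ 𝓐 s ∧ v ∈ ends i))) : Set ι)) x) → v' ≠ x → v' ∉ W →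
            v' ∈ openCluster (ends '' (↑((s ∆ E.filter (fun i => ∃ v, v ∈ 𝓐 s ∧ v ∈ ends i)) \ E.filter (fun i => ∃ v, v ∈ W ∧ v ∈ ends i)) : Set ι)) x ∧
            v' ∈ openCluster (ends '' (↑((E \ (s ∆ E.filter (fun i => ∃ v, v ∈ 𝓐 s ∧ v ∈ ends i))) \ E.filter (fun i => ∃ v, v ∈ W ∧ v ∈ ends i)) : Set ι)) x) ∧
        (∀ v ∈ W, ∀ i ∈ E, ∀ v', ends i = s(v, v') → ¬ (v' ∈ openCluster (ends '' (↑(s ∆ E.filter (fun i => ∃ v, v ∈ 𝓐 s ∧ v ∈ ends i)) : Set ι)) x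
              ∨ v' ∈ openCluster (ends '' (↑(E \ (s ∆ E.filter (fun i => ∃ v, v ∈ 𝓐 s ∧ v ∈ ends i))) : Set ι)) x) → v' ∈ W)} := by
      refine ⟨hxA, ?_, ?_, ?_⟩
      · rw [hL]; exact hlobe
      · exact (attached_flip_iff ends hs (𝓐 s) (𝓐 s) hxA subset_rfl hAtt).mpr hAtt
      · intro v hv i hi v' he hnz
        exact hCl v hv i hi v' he fun hz => hnz ((hUy v').mpr hz)
    have h := Set.sInter_subset_of_mem hmem
    rw [← h𝓐] at h
    exact h
  · -- `A*(s')` is in the family of `s`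
    have hsub : 𝓐 (s ∆ E.filter (fun i => ∃ v, v ∈ 𝓐 s ∧ v ∈ ends i)) ⊆ 𝓐 s := by
      have hmem : 𝓐 s ∈ {W : Set V | x ∉ W ∧
        openCluster (ends '' (↑(E.filter (fun i => ∀ y ∈ ends i,
          (y ∈ openCluster (ends '' (↑(s ∆ E.filter (fun i => ∃ v, v ∈ 𝓐 s ∧ v ∈ ends i)) : Set ι)) x
                ∨ y ∈ openCluster (ends '' (↑(E \ (s ∆ E.filter (fun i => ∃ v, v ∈ 𝓐 s ∧ v ∈ ends i))) : Set ι)) x) ∧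
          ¬ (y ∈ openCluster (ends '' (↑(s ∆ E.filter (fun i => ∃ v, v ∈ 𝓐 s ∧ v ∈ ends i)) : Set ι)) x
                ∧ y ∈ openCluster (ends '' (↑(E \ (s ∆ E.filter (fun i => ∃ v, v ∈ 𝓐 s ∧ v ∈ ends i))) : Set ι)) x))) : Set ι)) w ⊆ W ∧
        (∀ v ∈ W, ∀ i ∈ E, ∀ v', ends i = s(v, v') →
          (v' ∈ openCluster (ends '' (↑(s ∆ E.filter (fun i => ∃ v, v ∈ 𝓐 s ∧ v ∈ ends i)) : Set ι)) x
                ∨ v' ∈ openCluster (ends '' (↑(E \ (s ∆ E.filter (fun i => ∃ v, v ∈ 𝓐 s ∧ v ∈ ends i))) : Set ι)) x) → v' ≠ x → v' ∉ W →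
            v' ∈ openCluster (ends '' (↑((s ∆ E.filter (fun i => ∃ v, v ∈ 𝓐 s ∧ v ∈ ends i)) \ E.filter (fun i => ∃ v, v ∈ W ∧ v ∈ ends i)) : Set ι)) x ∧
            v' ∈ openCluster (ends '' (↑((E \ (s ∆ E.filter (fun i => ∃ v, v ∈ 𝓐 s ∧ v ∈ ends i))) \ E.filter (fun i => ∃ v, v ∈ W ∧ v ∈ ends i)) : Set ι)) x) ∧
        (∀ v ∈ W, ∀ i ∈ E, ∀ v', ends i = s(v, v') → ¬ (v' ∈ openCluster (ends '' (↑(s ∆ E.filter (fun i => ∃ v, v ∈ 𝓐 s ∧ v ∈ ends i)) : Set ι)) x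
              ∨ v' ∈ openCluster (ends '' (↑(E \ (s ∆ E.filter (fun i => ∃ v, v ∈ 𝓐 s ∧ v ∈ ends i))) : Set ι)) x) → v' ∈ W)} := by
        refine ⟨hxA, ?_, ?_, ?_⟩
        · rw [hL]; exact hlobe
        · exact (attached_flip_iff ends hs (𝓐 s) (𝓐 s) hxA subset_rfl hAtt).mpr hAtt
        · intro v hv i hi v' he hnz
          exact hCl v hv i hi v' he fun hz => hnz ((hUy v').mpr hz)
      have h := Set.sInter_subset_of_mem hmem
      rw [← h𝓐] at h
      exact h
    have hmem : 𝓐 (s ∆ E.filter (fun i => ∃ v, v ∈ 𝓐 s ∧ v ∈ ends i)) ∈ {W : Set V | x ∉ W ∧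
        openCluster (ends '' (↑(E.filter (fun i => ∀ y ∈ ends i,
          (y ∈ openCluster (ends '' (↑s : Set ι)) x ∨ y ∈ openCluster (ends '' (↑(E \ s) : Set ι)) x) ∧
          ¬ (y ∈ openCluster (ends '' (↑s : Set ι)) x ∧ y ∈ openCluster (ends '' (↑(E \ s) : Set ι)) x))) : Set ι)) w ⊆ W ∧
        (∀ v ∈ W, ∀ i ∈ E, ∀ v', ends i = s(v, v') →
          (v' ∈ openCluster (ends '' (↑s : Set ι)) x ∨ v' ∈ openCluster (ends '' (↑(E \ s) : Set ι)) x) → v' ≠ x → v' ∉ W →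
            v' ∈ openCluster (ends '' (↑(s \ E.filter (fun i => ∃ v, v ∈ W ∧ v ∈ ends i)) : Set ι)) x ∧
            v' ∈ openCluster (ends '' (↑((E \ s) \ E.filter (fun i => ∃ v, v ∈ W ∧ v ∈ ends i)) : Set ι)) x) ∧
        (∀ v ∈ W, ∀ i ∈ E, ∀ v', ends i = s(v, v') → ¬ (v' ∈ openCluster (ends '' (↑s : Set ι)) x ∨ v' ∈ openCluster (ends '' (↑(E \ s) : Set ι)) x)
              → v' ∈ W)} := by
      refine ⟨hxA', ?_, ?_, ?_⟩
      · rw [← hL]; exact hlobe'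
      · exact (attached_flip_iff ends hs (𝓐 s) _ hxA hsub hAtt).mp hAtt'
      · intro v hv i hi v' he hnz
        exact hCl' v hv i hi v' he fun hz => hnz ((hUy v').mp hz)
    have h := Set.sInter_subset_of_mem hmem
    rw [← h𝓐] at h
    exact h

open Classical in
/-- **Residue identity, kernel form.**  The point row `Σ_{s : wall} σ_u(s) σ_w(s)` equals its restriction to the ENTANGLED wall colourings, those whose
closed canonical attached set `A**(s)` contains `u`.
[cite: KozmaNitzan2024, Questions 8–9 (§5.5 p. 36) (context)] -/
theorem pointRow_sum_eq_sum_entangledClosed (ends : ι → Sym2 V) (E : Finset ι) (x z u w : V) :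
    ∑ s ∈ E.powerset.filter (fun s : Finset ι =>
        (z ∉ openCluster (ends '' (↑s : Set ι)) x ∧ z ∉ openCluster (ends '' (↑(E \ s) : Set ι)) x)),
      ((if u ∈ openCluster (ends '' (↑s : Set ι)) x then (1 : ℝ) else 0) - (if u ∈ openCluster (ends '' (↑(E \ s) : Set ι)) x then (1 : ℝ) else 0)) *
        ((if w ∈ openCluster (ends '' (↑s : Set ι)) x then (1 : ℝ) else 0) - (if w ∈ openCluster (ends '' (↑(E \ s) : Set ι)) x then (1 : ℝ) else 0))
    = ∑ s ∈ E.powerset.filter (fun s : Finset ι =>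
        (z ∉ openCluster (ends '' (↑s : Set ι)) x ∧ z ∉ openCluster (ends '' (↑(E \ s) : Set ι)) x) ∧
        u ∈ ⋂₀ {W : Set V | x ∉ W ∧
        openCluster (ends '' (↑(E.filter (fun i => ∀ y ∈ ends i,
          (y ∈ openCluster (ends '' (↑s : Set ι)) x ∨ y ∈ openCluster (ends '' (↑(E \ s) : Set ι)) x) ∧
          ¬ (y ∈ openCluster (ends '' (↑s : Set ι)) x ∧ y ∈ openCluster (ends '' (↑(E \ s) : Set ι)) x))) : Set ι)) w ⊆ W ∧
        (∀ v ∈ W, ∀ i ∈ E, ∀ v', ends i = s(v, v') →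
          (v' ∈ openCluster (ends '' (↑s : Set ι)) x ∨ v' ∈ openCluster (ends '' (↑(E \ s) : Set ι)) x) → v' ≠ x → v' ∉ W →
            v' ∈ openCluster (ends '' (↑(s \ E.filter (fun i => ∃ v, v ∈ W ∧ v ∈ ends i)) : Set ι)) x ∧
            v' ∈ openCluster (ends '' (↑((E \ s) \ E.filter (fun i => ∃ v, v ∈ W ∧ v ∈ ends i)) : Set ι)) x) ∧
        (∀ v ∈ W, ∀ i ∈ E, ∀ v', ends i = s(v, v') → ¬ (v' ∈ openCluster (ends '' (↑s : Set ι)) x ∨ v' ∈ openCluster (ends '' (↑(E \ s) : Set ι)) x)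
              → v' ∈ W)}),
      ((if u ∈ openCluster (ends '' (↑s : Set ι)) x then (1 : ℝ) else 0) - (if u ∈ openCluster (ends '' (↑(E \ s) : Set ι)) x then (1 : ℝ) else 0)) *
        ((if w ∈ openCluster (ends '' (↑s : Set ι)) x then (1 : ℝ) else 0) - (if w ∈ openCluster (ends '' (↑(E \ s) : Set ι)) x then (1 : ℝ) else 0)) := by
  by_cases hwx : w = x
  · subst hwx
    refine Finset.sum_congr (Finset.filter_congr fun s _ => ?_) fun _ _ => rfl
    constructor
    · intro h
      refine ⟨h, Set.mem_sInter.mpr fun W hW => ?_⟩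
      exact absurd (hW.2.1 (mem_openCluster_self _ _)) hW.1
    · exact fun h => h.1
  set 𝓐 : Finset ι → Set V := fun s => ⋂₀ {W : Set V | x ∉ W ∧
        openCluster (ends '' (↑(E.filter (fun i => ∀ y ∈ ends i,
          (y ∈ openCluster (ends '' (↑s : Set ι)) x ∨ y ∈ openCluster (ends '' (↑(E \ s) : Set ι)) x) ∧
          ¬ (y ∈ openCluster (ends '' (↑s : Set ι)) x ∧ y ∈ openCluster (ends '' (↑(E \ s) : Set ι)) x))) : Set ι)) w ⊆ W ∧
        (∀ v ∈ W, ∀ i ∈ E, ∀ v', ends i = s(v, v') →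
          (v' ∈ openCluster (ends '' (↑s : Set ι)) x ∨ v' ∈ openCluster (ends '' (↑(E \ s) : Set ι)) x) → v' ≠ x → v' ∉ W →
            v' ∈ openCluster (ends '' (↑(s \ E.filter (fun i => ∃ v, v ∈ W ∧ v ∈ ends i)) : Set ι)) x ∧
            v' ∈ openCluster (ends '' (↑((E \ s) \ E.filter (fun i => ∃ v, v ∈ W ∧ v ∈ ends i)) : Set ι)) x) ∧
        (∀ v ∈ W, ∀ i ∈ E, ∀ v', ends i = s(v, v') → ¬ (v' ∈ openCluster (ends '' (↑s : Set ι)) x ∨ v' ∈ openCluster (ends '' (↑(E \ s) : Set ι)) x)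
              → v' ∈ W)} with h𝓐def
  have h𝓐 : ∀ s : Finset ι, 𝓐 s = ⋂₀ {W : Set V | x ∉ W ∧
        openCluster (ends '' (↑(E.filter (fun i => ∀ y ∈ ends i,
          (y ∈ openCluster (ends '' (↑s : Set ι)) x ∨ y ∈ openCluster (ends '' (↑(E \ s) : Set ι)) x) ∧
          ¬ (y ∈ openCluster (ends '' (↑s : Set ι)) x ∧ y ∈ openCluster (ends '' (↑(E \ s) : Set ι)) x))) : Set ι)) w ⊆ W ∧
        (∀ v ∈ W, ∀ i ∈ E, ∀ v', ends i = s(v, v') →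
          (v' ∈ openCluster (ends '' (↑s : Set ι)) x ∨ v' ∈ openCluster (ends '' (↑(E \ s) : Set ι)) x) → v' ≠ x → v' ∉ W →
            v' ∈ openCluster (ends '' (↑(s \ E.filter (fun i => ∃ v, v ∈ W ∧ v ∈ ends i)) : Set ι)) x ∧
            v' ∈ openCluster (ends '' (↑((E \ s) \ E.filter (fun i => ∃ v, v ∈ W ∧ v ∈ ends i)) : Set ι)) x) ∧
        (∀ v ∈ W, ∀ i ∈ E, ∀ v', ends i = s(v, v') → ¬ (v' ∈ openCluster (ends '' (↑s : Set ι)) x ∨ v' ∈ openCluster (ends '' (↑(E \ s) : Set ι)) x)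
              → v' ∈ W)} := fun s => by
    simp only [h𝓐def]
  rw [pointRow_sum_eq_sum_not_good ends E x z u w 𝓐]
  refine Finset.sum_congr (Finset.filter_congr fun s hs => ?_) fun _ _ => rfl
  rw [Finset.mem_powerset] at hs
  have hx := not_mem_aStarClosed ends E x w hwx 𝓐 h𝓐 s
  have hw := mem_aStarClosed ends E x w 𝓐 h𝓐 s
  have hatt := attached_aStarClosed ends E x w 𝓐 h𝓐 s
  have hinv := aStarClosed_flip_eq ends E x w hwx 𝓐 h𝓐 s hs
  refine and_congr_right fun _ => ?_
  rw [← h𝓐 s]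
  constructor
  · intro hng
    by_contra hu
    exact hng ⟨⟨hx, hu, hw⟩, hinv, hatt⟩
  · intro hu hg
    exact hg.1.2.1 hu

open Classical in
/-- The wall colourings with `u ∉ A**(s)` contribute zero (the `A**`-involution pairs them off with opposite signs).
[cite: KozmaNitzan2024, Questions 8–9 (§5.5 p. 36) (context)] -/
theorem pointRow_sum_freeClosed_eq_zero (ends : ι → Sym2 V) (E : Finset ι) (x z u w : V) :
    ∑ s ∈ E.powerset.filter (fun s : Finset ι =>
        (z ∉ openCluster (ends '' (↑s : Set ι)) x ∧ z ∉ openCluster (ends '' (↑(E \ s) : Set ι)) x) ∧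
        u ∉ ⋂₀ {W : Set V | x ∉ W ∧
        openCluster (ends '' (↑(E.filter (fun i => ∀ y ∈ ends i,
          (y ∈ openCluster (ends '' (↑s : Set ι)) x ∨ y ∈ openCluster (ends '' (↑(E \ s) : Set ι)) x) ∧
          ¬ (y ∈ openCluster (ends '' (↑s : Set ι)) x ∧ y ∈ openCluster (ends '' (↑(E \ s) : Set ι)) x))) : Set ι)) w ⊆ W ∧
        (∀ v ∈ W, ∀ i ∈ E, ∀ v', ends i = s(v, v') →
          (v' ∈ openCluster (ends '' (↑s : Set ι)) x ∨ v' ∈ openCluster (ends '' (↑(E \ s) : Set ι)) x) → v' ≠ x → v' ∉ W →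
            v' ∈ openCluster (ends '' (↑(s \ E.filter (fun i => ∃ v, v ∈ W ∧ v ∈ ends i)) : Set ι)) x ∧
            v' ∈ openCluster (ends '' (↑((E \ s) \ E.filter (fun i => ∃ v, v ∈ W ∧ v ∈ ends i)) : Set ι)) x) ∧
        (∀ v ∈ W, ∀ i ∈ E, ∀ v', ends i = s(v, v') → ¬ (v' ∈ openCluster (ends '' (↑s : Set ι)) x ∨ v' ∈ openCluster (ends '' (↑(E \ s) : Set ι)) x)
              → v' ∈ W)}),
      ((if u ∈ openCluster (ends '' (↑s : Set ι)) x then (1 : ℝ) else 0) - (if u ∈ openCluster (ends '' (↑(E \ s) : Set ι)) x then (1 : ℝ) else 0)) *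
        ((if w ∈ openCluster (ends '' (↑s : Set ι)) x then (1 : ℝ) else 0) - (if w ∈ openCluster (ends '' (↑(E \ s) : Set ι)) x then (1 : ℝ) else 0)) = 0 := by
  have h := pointRow_sum_eq_sum_entangledClosed ends E x z u w
  set S₀ : Finset (Finset ι) := E.powerset.filter (fun s : Finset ι =>
      (z ∉ openCluster (ends '' (↑s : Set ι)) x ∧ z ∉ openCluster (ends '' (↑(E \ s) : Set ι)) x)) with hS₀
  set P : Finset ι → Prop := fun s : Finset ι =>
      u ∈ ⋂₀ {W : Set V | x ∉ W ∧
        openCluster (ends '' (↑(E.filter (fun i => ∀ y ∈ ends i,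
          (y ∈ openCluster (ends '' (↑s : Set ι)) x ∨ y ∈ openCluster (ends '' (↑(E \ s) : Set ι)) x) ∧
          ¬ (y ∈ openCluster (ends '' (↑s : Set ι)) x ∧ y ∈ openCluster (ends '' (↑(E \ s) : Set ι)) x))) : Set ι)) w ⊆ W ∧
        (∀ v ∈ W, ∀ i ∈ E, ∀ v', ends i = s(v, v') →
          (v' ∈ openCluster (ends '' (↑s : Set ι)) x ∨ v' ∈ openCluster (ends '' (↑(E \ s) : Set ι)) x) → v' ≠ x → v' ∉ W →
            v' ∈ openCluster (ends '' (↑(s \ E.filter (fun i => ∃ v, v ∈ W ∧ v ∈ ends i)) : Set ι)) x ∧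
            v' ∈ openCluster (ends '' (↑((E \ s) \ E.filter (fun i => ∃ v, v ∈ W ∧ v ∈ ends i)) : Set ι)) x) ∧
        (∀ v ∈ W, ∀ i ∈ E, ∀ v', ends i = s(v, v') → ¬ (v' ∈ openCluster (ends '' (↑s : Set ι)) x ∨ v' ∈ openCluster (ends '' (↑(E \ s) : Set ι)) x)
              → v' ∈ W)} with hP
  set f : Finset ι → ℝ := fun s : Finset ι =>
      ((if u ∈ openCluster (ends '' (↑s : Set ι)) x then (1 : ℝ) else 0) - (if u ∈ openCluster (ends '' (↑(E \ s) : Set ι)) x then (1 : ℝ) else 0)) *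
        ((if w ∈ openCluster (ends '' (↑s : Set ι)) x then (1 : ℝ) else 0) - (if w ∈ openCluster (ends '' (↑(E \ s) : Set ι)) x then (1 : ℝ) else 0)) with hf
  have h1 : ∑ s ∈ S₀, f s = ∑ s ∈ S₀.filter P, f s + ∑ s ∈ S₀.filter (fun s => ¬ P s), f s :=
    (Finset.sum_filter_add_sum_filter_not S₀ P f).symm
  have h2 : S₀.filter P = E.powerset.filter (fun s : Finset ι =>
      (z ∉ openCluster (ends '' (↑s : Set ι)) x ∧ z ∉ openCluster (ends '' (↑(E \ s) : Set ι)) x) ∧ P s) := by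
    rw [hS₀, Finset.filter_filter]
  have h3 : S₀.filter (fun s => ¬ P s) = E.powerset.filter (fun s : Finset ι =>
      (z ∉ openCluster (ends '' (↑s : Set ι)) x ∧ z ∉ openCluster (ends '' (↑(E \ s) : Set ι)) x) ∧ ¬ P s) := by
    rw [hS₀, Finset.filter_filter]
  have h' : ∑ s ∈ S₀, f s = ∑ s ∈ S₀.filter P, f s := by
    rw [h2]
    exact h
  rw [h3] at h1
  have : ∑ s ∈ E.powerset.filter (fun s : Finset ι => (z ∉ openCluster (ends '' (↑s : Set ι)) x ∧ z ∉ openCluster (ends '' (↑(E \ s) : Set ι)) x)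
        ∧ ¬ P s), f s = 0 := by
    linarith
  simpa only [hP, hf] using this

end Coefficientwise

end Summit.CriticalPhenomena.PercolationContinuityZ3.Theorems
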